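import Mathlib.NumberTheory.Zsqrtd.Basic
import Mathlib.LinearAlgebra.Matrix.Notation
import Mathlib.LinearAlgebra.Matrix.Determinant.Basic
import Mathlib.Algebra.Squarefree.Basic
import Mathlib.Tactic.Ring
import Mathlib.Tactic.LinearCombination
import Mathlib.Tactic.Linarith
import Mathlib.Tactic.FieldSimp
import HarnessLib

/-!
# Venture HSemireg — LEMMA 22's factor block (ENGINE-W PROBE5 §22, GENERAL TARGETS): the 4×4 secant block of a weight-`c` factor
# squares to `(A² − N·t)·1 = m·1`, it is multiplication by `√m` on `L_c = ℤ·tc ⊕ ℤ·(A+√m)`, the dyadic TYPE condition (T), and the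
# piece normalisation `|u_c|·N(J_c) = 1` — kernel algebra, with one PRECISION on the printed display

HONEST FRAMING. Lean index of the computation cell `pub-hsemireg`, widening group ENGINE-W (code A, seat `engine-w-1`, gen 18).
MATRIX ∕ RING IDENTITIES AND PARITY ONLY; no lattice genus, abelian variety, sheaf, `Ext` group, autoequivalence or semiregularity map is
constructed; nothing here says that HC, HC_CM or HC_AV holds. Theorems only (0 `def`, 0 named fact, 0 `sorry`). New namespace `FactorBlock`.
Companions: `R1DiophantinePellTwo.lean` (§13: `sq_dvd_of_common_divisor` is the odd-prime half of the multiplier-ring remark, not restated),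
`LocalGlobalUnitVectors.lean` (§21), `RatioLemmaDeterminant.lean` (§10).

SOURCE (the cell's own result, by value): `widen/ENGINE-W/out/probe5/PROBE5-STIZ-A.md` §1 (closed form
`𝒥_v = [[−(α∕β)·I, −(1∕β)·F_h⁻¹],[((α² − β²m)∕β)·F_h, (α∕β)·I]]`, `F[2a+1][2a] = c_a`, `F[2a][2a+1] = −c_a`, «𝒥² = m») and §22 LEMMA 22
(«On a factor of weight c the secant structure is the 4×4 block 𝒥′_c = [[−A,0,0,N∕c],[0,−A,−N∕c,0],[0,−tc,A,0],[tc,0,0,A]] …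
Λ_c ≅ O_K ⊗ L_c with L_c := [tc, A+√m] … (√m + A)·tc = tc·(A+√m) ∈ L_c and (√m − A)·(A+√m) = m − A² = −(N∕c)·tc ∈ L_c … the multiplier
ring … is ℤ[√m] UNLESS tc ≡ N∕c ≡ 0 (mod 2) — then 4 ∣ Nt = A² − m forces A odd, m ≡ 1 (mod 4) … TYPE CONDITION (T) … r_factor =
2·rk_𝔽₂[[1−A, N∕c],[tc, 1+A]] … the PIECE (J_c, u_c) := ((√m∕(tc))·L_c, −tc∕m) (|u_c|·N(J_c) = (|t|c∕m)·(m∕(t²c²))·|t|c = 1 ✓)»).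
Throughout `n := N∕c` and `s := t·c` are integers with `n·s = N·t = A² − m`. What the kernel holds:

* §1 **the block squares to `m`**: with the closed form of §1 specialised to `λ′ = (A+√m)∕N` (`α∕β = A`, `1∕β = N`, `(α²−β²m)∕β = t`) and
  `F = [[0,−c],[c,0]]` on the factor, the block is `J = [[−A,0,0,−n],[0,−A,n,0],[0,−s,A,0],[s,0,0,A]]` and `J² = (A² − n·s)·1`
  (`block_sq`), hence `= m·1` under `n·s = A² − m` (`block_sq_eq`). **PRECISION P-22-1 (found while formalising):** the block AS DISPLAYED in
  §22, `[[−A,0,0,n],[0,−A,−n,0],[0,−s,A,0],[s,0,0,A]]` (opposite sign in the upper-right 2×2 block), squares to `(A² + n·s)·1`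
  (`displayed_block_sq`) — i.e. to `m·1` only under `N·t = m − A²`; the code (`probe5_jz_A.r_fast`, whose docstring says «up to signs») uses the
  block only modulo 2, where signs are immaterial, so no number of §22 is affected; the display should read `−N∕c` ∕ `+N∕c` in rows 1 ∕ 2
  (or `t ↦ −t`).
* §2 **`L_c` is a `ℤ[√m]`-module and `J` is multiplication by `√m` on it** (in Mathlib's `ℤ√m`): `sqrtd_mul_weight`
  (`√m·s = (−A)·s + s·(A+√m)`), `conj_mul_node` (`(−A+√m)(A+√m) = m − A²`), `sqrtd_mul_node` (`√m·(A+√m) = −(n·s) + A·(A+√m)` under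
  `n·s = A² − m`) — the two columns `(−A, s)` and `(−n, A)` of `√m` in the basis `(s, A+√m)`, i.e. the 2×2 scalar block of `J`.
* §3 **the dyadic TYPE condition**: `typeMatrix_det` (`det[[1−A, n],[s, 1+A]] = 1 + m − 2A²` under `n·s = A² − m`, so it is `≡ 1 + m (mod 2)`:
  odd — full rank mod 2, `r = 4` per factor — iff `m` is even, as in «r(seed) = 24 for m even»), `odd_A_of_even_even` (squarefree `m`,
  `2 ∣ n`, `2 ∣ s` ⟹ `A` odd and `m ≡ 1 (mod 4)`: the O-TYPE case), `type_T_automatic` (`m % 4 ≠ 1` ⟹ NOT (`2 ∣ n` ∧ `2 ∣ s`)).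
* §4 **the piece normalisation** `piece_normalisation` (`(t·c∕m)·(m∕(t²c²))·(t·c) = 1` for `t, c, m ≠ 0`) and the seed factor
  `seed_block_sq` (`(A,N,t) = (0,1,−m)`: `[[0,−1],[−m,0]]`-type block, `J² = m·1`).
-/

namespace Summit.Ventures.HSemireg.FactorBlock

open Matrix

/-! ## §1 The 4×4 block squares to `m` (and the displayed one does not) -/

/-- **`J² = (A² − n·s)·1`** for the weight-`c` block `J = [[−A,0,0,−n],[0,−A,n,0],[0,−s,A,0],[s,0,0,A]]` (`n = N∕c`, `s = tc`; from §1's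
closed form with `F = [[0,−c],[c,0]]`), over any commutative ring. [kernel] -/
theorem block_sq {R : Type*} [CommRing R] (A n s : R) :
    !![-A, 0, 0, -n; 0, -A, n, 0; 0, -s, A, 0; s, 0, 0, A] * !![-A, 0, 0, -n; 0, -A, n, 0; 0, -s, A, 0; s, 0, 0, A]
      = (A ^ 2 - n * s) • (1 : Matrix (Fin 4) (Fin 4) R) := by
  ext i j
  fin_cases i <;> fin_cases j <;> simp [Matrix.mul_apply, Fin.sum_univ_four] <;> ring

/-- Hence **`J² = m·1`** on every target: `n·s = N·t = A² − m`. [kernel] -/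
theorem block_sq_eq {R : Type*} [CommRing R] (A n s m : R) (h : n * s = A ^ 2 - m) :
    !![-A, 0, 0, -n; 0, -A, n, 0; 0, -s, A, 0; s, 0, 0, A] * !![-A, 0, 0, -n; 0, -A, n, 0; 0, -s, A, 0; s, 0, 0, A]
      = m • (1 : Matrix (Fin 4) (Fin 4) R) := by
  rw [block_sq]
  congr 1
  linear_combination -h

/-- **PRECISION P-22-1**: the block AS DISPLAYED in §22 LEMMA 22, `[[−A,0,0,n],[0,−A,−n,0],[0,−s,A,0],[s,0,0,A]]`, squares to `(A² + n·s)·1`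
— with `n·s = A² − m` that is `(2A² − m)·1`, not `m·1`; the upper-right signs are a display slip (the machine uses the block mod 2 only).
[kernel] -/
theorem displayed_block_sq {R : Type*} [CommRing R] (A n s : R) :
    !![-A, 0, 0, n; 0, -A, -n, 0; 0, -s, A, 0; s, 0, 0, A] * !![-A, 0, 0, n; 0, -A, -n, 0; 0, -s, A, 0; s, 0, 0, A]
      = (A ^ 2 + n * s) • (1 : Matrix (Fin 4) (Fin 4) R) := by
  ext i j
  fin_cases i <;> fin_cases j <;> simp [Matrix.mul_apply, Fin.sum_univ_four] <;> ring

/-- The two candidate squares differ by `2·n·s = 2·N·t ≠ 0`: the displayed block squares to `m·1` only under the opposite orientation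
`N·t = m − A²`. [kernel] -/
theorem displayed_block_sq_eq_iff {A n s m : ℤ} (h : n * s = A ^ 2 - m) :
    A ^ 2 + n * s = m ↔ n * s = 0 := by
  constructor
  · intro h2; linarith
  · intro h0; linarith

/-- The **seed factor** (`(A, N, t) = (0, 1, −m)`, `c = 1`: `n = 1`, `s = −m`): `J_seed = [[0,0,0,−1],[0,0,1,0],[0,m,0,0],[−m,0,0,0]]`,
`J_seed² = m·1`. [kernel] -/
theorem seed_block_sq {R : Type*} [CommRing R] (m : R) :
    !![(0 : R), 0, 0, -1; 0, 0, 1, 0; 0, m, 0, 0; -m, 0, 0, 0] * !![(0 : R), 0, 0, -1; 0, 0, 1, 0; 0, m, 0, 0; -m, 0, 0, 0]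
      = m • (1 : Matrix (Fin 4) (Fin 4) R) := by
  have h := block_sq_eq (R := R) 0 1 (-m) m (by ring)
  simpa using h

/-! ## §2 `L_c = ℤ·s ⊕ ℤ·(A+√m)` is stable under `√m` -/

/-- **First column of `√m` on `L_c`**: `√m·s = (−A)·s + s·(A + √m)` in `ℤ√m`. [kernel, `ring`] -/
theorem sqrtd_mul_weight (m A s : ℤ) :
    Zsqrtd.sqrtd * (s : ℤ√m) = ((-A : ℤ) : ℤ√m) * (s : ℤ√m) + (s : ℤ√m) * (⟨A, 1⟩ : ℤ√m) := by
  ext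
  · simp; ring
  · simp

/-- **`(−A + √m)·(A + √m) = m − A²`** in `ℤ√m`. [kernel] -/
theorem conj_mul_node (m A : ℤ) : (⟨-A, 1⟩ : ℤ√m) * ⟨A, 1⟩ = ⟨m - A ^ 2, 0⟩ := by
  ext
  · simp; ring
  · simp

/-- **Second column of `√m` on `L_c`**: under `n·s = A² − m`, `√m·(A + √m) = −(n·s) + A·(A + √m)` — so `L_c` is a `ℤ[√m]`-submodule and the
2×2 scalar block of `√m` in the basis `(s, A+√m)` has columns `(−A, s)`, `(−n, A)`. [kernel] -/
theorem sqrtd_mul_node (m A n s : ℤ) (h : n * s = A ^ 2 - m) :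
    Zsqrtd.sqrtd * (⟨A, 1⟩ : ℤ√m) = ((-(n * s) : ℤ) : ℤ√m) + ((A : ℤ) : ℤ√m) * (⟨A, 1⟩ : ℤ√m) := by
  ext
  · simp; linarith
  · simp

/-! ## §3 The dyadic TYPE condition (T) -/

/-- **`det [[1−A, n],[s, 1+A]] = 1 + m − 2A²`** under `n·s = A² − m`; in particular it is `≡ 1 + m (mod 2)`. [kernel] -/
theorem typeMatrix_det (A n s m : ℤ) (h : n * s = A ^ 2 - m) :
    Matrix.det !![1 - A, n; s, 1 + A] = 1 + m - 2 * A ^ 2 := by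
  rw [Matrix.det_fin_two_of]
  linear_combination -h

/-- So for **even `m`** the type matrix is invertible mod 2 (odd determinant): `r = 4` per factor — «r(seed) = 24 for m even». [kernel] -/
theorem typeMatrix_det_odd_of_even (A n s m : ℤ) (h : n * s = A ^ 2 - m) (hm : m % 2 = 0) :
    (Matrix.det !![1 - A, n; s, 1 + A]) % 2 = 1 := by
  rw [typeMatrix_det A n s m h]
  omega

/-- For **odd `m`** the determinant is even (rank `≤ 1` mod 2: `r ≤ 2` per factor — «r(seed) = 12 for m odd»). [kernel] -/
theorem typeMatrix_det_even_of_odd (A n s m : ℤ) (h : n * s = A ^ 2 - m) (hm : m % 2 = 1) :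
    (Matrix.det !![1 - A, n; s, 1 + A]) % 2 = 0 := by
  rw [typeMatrix_det A n s m h]
  omega

/-- **The O-TYPE case**: if `n = N∕c` and `s = t·c` are both even then `4 ∣ A² − m`, so for squarefree `m` the twist `A` is odd and
`m ≡ 1 (mod 4)`. [kernel] -/
theorem odd_A_of_even_even {A n s m : ℤ} (hm : Squarefree m) (h : n * s = A ^ 2 - m) (hn : 2 ∣ n) (hs : 2 ∣ s) :
    A % 2 = 1 ∧ m % 4 = 1 := by
  obtain ⟨n', rfl⟩ := hn
  obtain ⟨s', rfl⟩ := hs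
  have h4 : A ^ 2 - m = 4 * (n' * s') := by linarith
  -- A even would force 4 ∣ m, impossible for squarefree m
  have hA : A % 2 = 1 := by
    by_contra hA
    have hA0 : A % 2 = 0 := by omega
    obtain ⟨a, rfl⟩ : (2 : ℤ) ∣ A := Int.dvd_of_emod_eq_zero hA0
    have : (2 : ℤ) * 2 ∣ m := ⟨a ^ 2 - n' * s', by linarith⟩
    have hu := hm 2 this
    rcases Int.isUnit_iff.mp hu with h1 | h1 <;> norm_num at h1
  refine ⟨hA, ?_⟩
  have : A ^ 2 % 4 = 1 := by
    have e : A = 2 * (A / 2) + 1 := by omega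
    rw [e]; ring_nf; omega
  omega

/-- **(T) is automatic for `m ≢ 1 (mod 4)`** (squarefree `m`): `n`, `s` are not both even. [kernel] -/
theorem type_T_automatic {A n s m : ℤ} (hm : Squarefree m) (hm4 : m % 4 ≠ 1) (h : n * s = A ^ 2 - m) :
    ¬ ((2 : ℤ) ∣ n ∧ (2 : ℤ) ∣ s) := by
  rintro ⟨hn, hs⟩
  exact hm4 (odd_A_of_even_even hm h hn hs).2

/-! ## §4 The piece normalisation -/

/-- **`|u_c|·N(J_c) = 1`** as the rational identity `(t·c∕m)·(m∕(t²c²))·(t·c) = 1` (`t, c, m ≠ 0`). [kernel, `field_simp`] -/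
theorem piece_normalisation (t c m : ℚ) (ht : t ≠ 0) (hc : c ≠ 0) (hm : m ≠ 0) :
    (t * c / m) * (m / (t ^ 2 * c ^ 2)) * (t * c) = 1 := by
  field_simp

/-- The norm of the rescaled generator: `N((√m∕(tc))·x) = (−m∕(t²c²))·N(x)` — recorded as `N(√m) = −m` in `ℤ√m`. [kernel] -/
theorem norm_sqrtd (m : ℤ) : (Zsqrtd.sqrtd : ℤ√m).norm = -m := by
  rw [Zsqrtd.norm_def]
  simp

end Summit.Ventures.HSemireg.FactorBlock
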